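import Mathlib
import HarnessLib
import Summits.ValiantsHypothesis.ValiantsHypothesis.Theorems.MonotoneRestorationOrbitRestorationQPLocalFactors
import Summits.ValiantsHypothesis.ValiantsHypothesis.Theorems.MonotoneRestorationOrbitRestorationQPLocalFormShape
import Summits.ValiantsHypothesis.ValiantsHypothesis.Theorems.MonotoneRestorationOrbitRestorationQPStableLocalFactors

/-!
# Untwisted matrix-symmetric affine products lie in the treewidth-`≤ 2k−1` span (SPAN currency; A₁'s untwisted class)

Route MonotoneRestoration, crux `OrbitRestorationQP` (stmt-ValiantsHypothesis-18293), SPAN-currency lane of the open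
sub-rung A_∞ (`stub_sigmaPiSigmaValue`); evidence note `SPAN-CURRENCY-A1-g7g4.md` §7.  Helper (`--supports`), def-free.
The glue from the route's structure theorem to the span-currency mechanism:

* `exists_placed_localForm` — a row/column-supported affine form (`LocalFormShape`) IS a local affine form PLACED at an
  injective placement of `Fin |R| × Fin |C|` (reindexing the supports);
* `exists_placed_localForm_of_factor` — every factor of a matrix-symmetric affine product `C a · Π L` with `|L| < C(n,k)`
  (`8 < n`, `1 ≤ k`, `4k ≤ n`) is a placed local affine form with core sizes `< k`
  (`LocalFactors.exists_rowColSupports_of_matrixSymmetric` + the above);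
* **`prod_mem_narrowSpan_of_untwisted_matrixSymmetric`** — THE UNTWISTED `ΠΣ` THEOREM: if moreover the factor family is
  EXACTLY permuted by every row/column permutation (untwisted), then `C a · Π_i L_i ∈ span_ℂ {hom_{F,n} : tw F ≤ 2k - 1}`
  (`CorePatterns.prod_mem_narrowSpan_of_stable_localFactors`): constant treewidth, hence POLYNOMIAL orbits — the span-currency
  strengthening of the landed orbit-currency A₁ on the untwisted class.

Honest label: the untwisted sub-class of the `ΠΣ` sub-rung (twisted line-orbits need the even-subalgebra pairing of
`…ColumnVandermondesNarrow.lean`); the stub A_∞, the crux and VP ≠ VNP are not moved.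
-/

noncomputable section

-- `Summit.ValiantsHypothesis.ValiantsHypothesis.…` is the tree's single-conjunct layout (Sub = Summit).
set_option linter.dupNamespace false

namespace Summit.ValiantsHypothesis.ValiantsHypothesis.Theorems

namespace CorePatterns

open MvPolynomial Finset Equiv ProductAction
open Literature.Computability.AlgebraicComplexity (homPoly)
open Literature.Combinatorics.SimpleGraph (treewidth)

variable {n : ℕ}

/-- **A row/column-supported affine form is a PLACED local affine form** (core `Fin |R| × Fin |C|`). [folklore] -/
theorem exists_placed_localForm (ℓ : MvPolynomial (Fin n × Fin n) ℂ) (hdeg : ℓ.totalDegree ≤ 1) (R S : Finset (Fin n))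
    (hrow : ∀ ρ : Perm (Fin n), (∀ x ∈ R, ρ x = x) → rename (fun P : Fin n × Fin n => (ρ P.1, P.2)) ℓ = ℓ)
    (hcol : ∀ ρ : Perm (Fin n), (∀ x ∈ S, ρ x = x) → rename (fun P : Fin n × Fin n => (P.1, ρ P.2)) ℓ = ℓ) :
    ∃ (eR : Fin R.card → Fin n) (eC : Fin S.card → Fin n) (β₀ δ : ℂ) (α : Fin R.card × Fin S.card → ℂ)
      (β : Fin R.card → ℂ) (γ : Fin S.card → ℂ), Function.Injective eR ∧ Function.Injective eC ∧
      ℓ = (C β₀ + C δ * ∑ i : Fin n, ∑ j : Fin n, (X (i, j) : MvPolynomial (Fin n × Fin n) ℂ)) +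
        ((∑ ab : Fin R.card × Fin S.card, C (α ab) * (X (eR ab.1, eC ab.2) : MvPolynomial (Fin n × Fin n) ℂ)) +
          (∑ a : Fin R.card, C (β a) * ∑ j : Fin n, (X (eR a, j) : MvPolynomial (Fin n × Fin n) ℂ)) +
          (∑ b : Fin S.card, C (γ b) * ∑ j : Fin n, (X (j, eC b) : MvPolynomial (Fin n × Fin n) ℂ))) := by
  classical
  obtain ⟨β₀, δ, α, β, γ, h⟩ := LocalFormShape.eq_localForm_of_rowCol_invariant ℓ hdeg R S hrow hcol
  refine ⟨fun i => (R.equivFin.symm i).1, fun j => (S.equivFin.symm j).1, β₀, δ,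
    fun ij => α ((R.equivFin.symm ij.1).1, (S.equivFin.symm ij.2).1), fun i => β (R.equivFin.symm i).1,
    fun j => γ (S.equivFin.symm j).1, ?_, ?_, ?_⟩
  · intro i j hij
    exact R.equivFin.symm.injective (Subtype.ext hij)
  · intro i j hij
    exact S.equivFin.symm.injective (Subtype.ext hij)
  · rw [h]
    congr 2
    · congr 1
      · -- cells
        rw [Fintype.sum_prod_type, ← Finset.sum_coe_sort R,
          ← Equiv.sum_comp R.equivFin.symm]
        refine Finset.sum_congr rfl fun i _ => ?_
        rw [← Finset.sum_coe_sort S, ← Equiv.sum_comp S.equivFin.symm]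
      · -- row pendants
        rw [← Finset.sum_coe_sort R, ← Equiv.sum_comp R.equivFin.symm]
    · -- column pendants
      rw [← Finset.sum_coe_sort S, ← Equiv.sum_comp S.equivFin.symm]

/-- **Every factor of a matrix-symmetric affine product is a placed local affine form with core sizes `< k`.**
[cite: DixonMortimer1996, Thm 5.2B; DawarWilsenach2025, Def. 6.1] -/
theorem exists_placed_localForm_of_factor {k : ℕ} (hn : 8 < n) (hk : 1 ≤ k) (h4k : 4 * k ≤ n)
    {L : Multiset (MvPolynomial (Fin n × Fin n) ℂ)} {a : ℂ}
    (hL : ∀ ℓ ∈ L, ℓ.totalDegree ≤ 1) (hcard : Multiset.card L < n.choose k) (hf0 : C a * L.prod ≠ 0)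
    (hrow : ∀ σ : Perm (Fin n), vact (K := ℂ) rowHom σ (C a * L.prod) = C a * L.prod)
    (hcol : ∀ τ : Perm (Fin n), vact (K := ℂ) colHom τ (C a * L.prod) = C a * L.prod)
    (ℓ : MvPolynomial (Fin n × Fin n) ℂ) (hℓ : ℓ ∈ L) :
    ∃ (r c : ℕ) (eR : Fin r → Fin n) (eC : Fin c → Fin n) (β₀ δ : ℂ) (α : Fin r × Fin c → ℂ)
      (β : Fin r → ℂ) (γ : Fin c → ℂ), r < k ∧ c < k ∧ Function.Injective eR ∧ Function.Injective eC ∧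
      ℓ = (C β₀ + C δ * ∑ i : Fin n, ∑ j : Fin n, (X (i, j) : MvPolynomial (Fin n × Fin n) ℂ)) +
        ((∑ ab : Fin r × Fin c, C (α ab) * (X (eR ab.1, eC ab.2) : MvPolynomial (Fin n × Fin n) ℂ)) +
          (∑ a : Fin r, C (β a) * ∑ j : Fin n, (X (eR a, j) : MvPolynomial (Fin n × Fin n) ℂ)) +
          (∑ b : Fin c, C (γ b) * ∑ j : Fin n, (X (j, eC b) : MvPolynomial (Fin n × Fin n) ℂ))) := by
  classical
  obtain ⟨R, S, -, -, -, -, -, -, -, -, hfac⟩ :=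
    LocalFactors.exists_rowColSupports_of_matrixSymmetric (K := ℂ) hn hk h4k hL hcard hf0 hrow hcol
  obtain ⟨hRk, hSk, hRfix, hSfix, -⟩ := hfac ℓ hℓ
  have hrow' : ∀ ρ : Perm (Fin n), (∀ x ∈ R ℓ, ρ x = x) →
      rename (fun P : Fin n × Fin n => (ρ P.1, P.2)) ℓ = ℓ := by
    intro ρ hρ
    have h := hRfix ρ hρ
    rw [vact_apply] at h
    have hf : (⇑(rowHom ρ) : Fin n × Fin n → Fin n × Fin n) = fun P => (ρ P.1, P.2) := funext (rowHom_apply ρ)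
    rwa [hf] at h
  have hcol' : ∀ ρ : Perm (Fin n), (∀ x ∈ S ℓ, ρ x = x) →
      rename (fun P : Fin n × Fin n => (P.1, ρ P.2)) ℓ = ℓ := by
    intro ρ hρ
    have h := hSfix ρ hρ
    rw [vact_apply] at h
    have hf : (⇑(colHom ρ) : Fin n × Fin n → Fin n × Fin n) = fun P => (P.1, ρ P.2) := funext (colHom_apply ρ)
    rwa [hf] at h
  obtain ⟨eR, eC, β₀, δ, α, β, γ, heR, heC, hshape⟩ := exists_placed_localForm ℓ (hL ℓ hℓ) (R ℓ) (S ℓ) hrow' hcol'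
  exact ⟨(R ℓ).card, (S ℓ).card, eR, eC, β₀, δ, α, β, γ, hRk, hSk, heR, heC, hshape⟩

/-- **THE UNTWISTED `ΠΣ` THEOREM IN SPAN CURRENCY.**  Let `f = C a · Π_i L_i` (`L : ι → K[x]` finitely many affine factors,
`|ι| < C(n,k)`, `8 < n`, `1 ≤ k`, `4k ≤ n`, `f ≠ 0`) be invariant under all row and all column permutations, and suppose
the factor family is UNTWISTED: every `(σ, τ)` permutes the factors exactly.  Then
`f ∈ span_ℂ {hom_{F,n} : tw F ≤ 2k - 1}`. [folklore; cite: DwivediPagoSeppelt2026, §8; DixonMortimer1996, Thm 5.2B] -/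
theorem prod_mem_narrowSpan_of_untwisted_matrixSymmetric {k : ℕ} (hn : 8 < n) (hk : 1 ≤ k) (h4k : 4 * k ≤ n)
    {ι : Type} [Fintype ι] (L : ι → MvPolynomial (Fin n × Fin n) ℂ) (a : ℂ)
    (hL : ∀ i, (L i).totalDegree ≤ 1) (hcard : Fintype.card ι < n.choose k) (hf0 : C a * ∏ i, L i ≠ 0)
    (hrow : ∀ σ : Perm (Fin n), vact (K := ℂ) rowHom σ (C a * ∏ i, L i) = C a * ∏ i, L i)
    (hcol : ∀ τ : Perm (Fin n), vact (K := ℂ) colHom τ (C a * ∏ i, L i) = C a * ∏ i, L i)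
    (huntwisted : ∀ σ τ : Perm (Fin n), ∃ κ : Perm ι, ∀ i,
      rename (fun P : Fin n × Fin n => (σ P.1, τ P.2)) (L i) = L (κ i)) :
    (C a * ∏ i, L i) ∈ Submodule.span ℂ {p : MvPolynomial (Fin n × Fin n) ℂ |
        ∃ (a b : ℕ) (E : Multiset (Fin a × Fin b)),
          treewidth (SimpleGraph.fromRel fun u v : Fin a ⊕ Fin b =>
            ∃ e ∈ E, u = Sum.inl e.1 ∧ v = Sum.inr e.2) ≤ 2 * k - 1 ∧ p = homPoly E n ℂ} := by
  classical
  -- the factor multiset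
  set M : Multiset (MvPolynomial (Fin n × Fin n) ℂ) := (univ : Finset ι).val.map L with hM
  have hMprod : C a * M.prod = C a * ∏ i, L i := by rw [hM, Finset.prod_eq_multiset_prod]
  have hML : ∀ ℓ ∈ M, ℓ.totalDegree ≤ 1 := by
    intro ℓ hℓ
    rw [hM, Multiset.mem_map] at hℓ
    obtain ⟨i, -, rfl⟩ := hℓ
    exact hL i
  have hMcard : Multiset.card M < n.choose k := by rwa [hM, Multiset.card_map, Finset.card_val, Finset.card_univ]
  have hMf0 : C a * M.prod ≠ 0 := by rwa [hMprod]
  have hMrow : ∀ σ : Perm (Fin n), vact (K := ℂ) rowHom σ (C a * M.prod) = C a * M.prod := by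
    intro σ; rw [hMprod]; exact hrow σ
  have hMcol : ∀ τ : Perm (Fin n), vact (K := ℂ) colHom τ (C a * M.prod) = C a * M.prod := by
    intro τ; rw [hMprod]; exact hcol τ
  have hloc : ∀ i, ∃ (r c : ℕ) (eR : Fin r → Fin n) (eC : Fin c → Fin n) (β₀ δ : ℂ) (α : Fin r × Fin c → ℂ)
      (β : Fin r → ℂ) (γ : Fin c → ℂ), r + c + 1 ≤ 2 * k - 1 ∧ Function.Injective eR ∧ Function.Injective eC ∧
      L i = (C β₀ + C δ * ∑ i : Fin n, ∑ j : Fin n, (X (i, j) : MvPolynomial (Fin n × Fin n) ℂ)) +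
        ((∑ ab : Fin r × Fin c, C (α ab) * (X (eR ab.1, eC ab.2) : MvPolynomial (Fin n × Fin n) ℂ)) +
          (∑ a : Fin r, C (β a) * ∑ j : Fin n, (X (eR a, j) : MvPolynomial (Fin n × Fin n) ℂ)) +
          (∑ b : Fin c, C (γ b) * ∑ j : Fin n, (X (j, eC b) : MvPolynomial (Fin n × Fin n) ℂ))) := by
    intro i
    obtain ⟨r, c, eR, eC, β₀, δ, α, β, γ, hr, hc, heR, heC, hshape⟩ :=
      exists_placed_localForm_of_factor hn hk h4k hML hMcard hMf0 hMrow hMcol (L i)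
        (by rw [hM]; exact Multiset.mem_map_of_mem _ (Finset.mem_univ_val i))
    exact ⟨r, c, eR, eC, β₀, δ, α, β, γ, by omega, heR, heC, hshape⟩
  have hprod := prod_mem_narrowSpan_of_stable_localFactors n (2 * k - 1) L huntwisted hloc
  rw [← smul_eq_C_mul]
  exact Submodule.smul_mem _ _ hprod

end CorePatterns

end Summit.ValiantsHypothesis.ValiantsHypothesis.Theorems

end
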